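import Summits.NavierStokesRegularity.NavierStokesRegularity.Theorems.SoloSalvageWu2026TangentLocal
import Literature.Analysis.FunctionSpaces.WeakLpFatou
import Mathlib.MeasureTheory.Function.ConvergenceInMeasure
import Mathlib.MeasureTheory.Measure.Lebesgue.EqHaar
import HarnessLib

/-!
# C177 `Wu2026` — tools for the sub-binders of `Step_construct` (§3.2–§3.4): scaling of
# distribution functions under the blow-down, levelwise Fatou through `L^q` limits, and the
# `L^q(K)` convergences of the blow-down sequence (cell `pub/ns-inputs`, seat `ns-in-wu-con`;
# route business of `GaldiLiouvilleGate`, item stmt-NavierStokesRegularity-0897)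

Tools shared by the pieces (C), (D) of the assembly `step_construct_of_pieces`
(`SoloSalvageWu2026Construct.lean`):

* `meas_lt_norm_le_of_tendsto_eLpNorm` — levelwise bounds `μ{t < |f_n|} ≤ B` pass to `L^q` limits
  (a.e.-convergent subsequence + Fatou for distribution functions,
  `Literature.Analysis.FunctionSpaces.measure_lt_enorm_le_liminf_of_ae_tendsto`; Wu's Lemma 3.2
  p.11 in levelwise form);
* `meas_lt_norm_rescaled_le` — exact scaling of superlevel sets under `g = R^a f(R·)`, `ar = 3`
  (the Lorentz-scale invariance (1.3) p.2, (3.20)–(3.25) p.10–11), and its instances for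
  `V_R = R^{2/3}v(R·)` (exponent `9/2`), `Q_R = R^{4/3}𝒬(R·)` (`9/4`), `Q_RV_R` (`3/2`, through
  `{t < |Q||V|} ⊆ {t^{2/3} < |Q|} ∪ {t^{1/3} < |V|}`);
* the closed dyadic shell `{R ≤ |y| ≤ 2R}` (compact, in `ℝ³ ∖ {0}`, contains `A_R`);
* the passage from the real-integral convergences (3.28)/(3.45) of the skeleton (`Tangent.convV`,
  `Tangent.convP` shape, `q₀ = 4`) to `ℝ≥0∞` / `eLpNorm` form, and the `L¹(K)` convergences
  `Q_j → Q`, `Q_jV_j → QV` (Hölder on a set of finite measure; `tendsto_lintegral_six_terms` of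
  `…TangentLimit`).

Theorems only, standard axioms, no `sorry`.

WHAT THIS IS NOT: not a proof of `Step_construct`; not a claim about NS regularity or blow-up; not
a claim about any author beyond the typed locator.
-/

set_option linter.dupNamespace false

noncomputable section

open MeasureTheory Set Filter Topology Module Metric
open scoped ENNReal NNReal Topology RealInnerProductSpace Pointwise

namespace Summit.NavierStokesRegularity.NavierStokesRegularity.Theorems.Wu2026Salvage

open Literature.Analysis.FluidPDE Literature.Analysis.FunctionSpaces Literature.Claims.NS.Wu2026

/-! ## Levelwise bounds pass to `L^q` limits -/

/-- **Levelwise Fatou through an `L^q` limit**: if `f_n → g` in `L^q(μ)` (`q ≠ 0`) and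
`μ{t < ‖f_n‖} ≤ B` for every `n` at a fixed level `t > 0`, then `μ{t < ‖g‖} ≤ B` (a.e.-convergent
subsequence and Fatou for the distribution function; Wu's Lemma 3.2 p.11 in levelwise form).
[cite: Wu2026, Lemma 3.2 p.11 l.53–92] -/
theorem meas_lt_norm_le_of_tendsto_eLpNorm {α : Type*} [MeasurableSpace α] {F : Type*}
    [NormedAddCommGroup F] {μ : Measure α} {f : ℕ → α → F} {g : α → F}
    (hf : ∀ n, AEStronglyMeasurable (f n) μ) (hg : AEStronglyMeasurable g μ)
    {q : ℝ≥0∞} (hq : q ≠ 0) (hlim : Tendsto (fun n => eLpNorm (f n - g) q μ) atTop (𝓝 0))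
    {t : ℝ} (ht : 0 < t) {B : ℝ≥0∞} (hB : ∀ n, μ {x | t < ‖f n x‖} ≤ B) :
    μ {x | t < ‖g x‖} ≤ B := by
  obtain ⟨ns, -, hae⟩ := (tendstoInMeasure_of_tendsto_eLpNorm hq hf hg hlim).exists_seq_tendsto_ae
  have h := measure_lt_enorm_le_liminf_of_ae_tendsto (fun k => hf (ns k)) hg hae (ENNReal.ofReal t)
  have hset : ∀ h : α → F, {x | ENNReal.ofReal t < ‖h x‖ₑ} = {x | t < ‖h x‖} := fun h => by
    ext x
    simp only [mem_setOf_eq]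
    rw [← ofReal_norm, ENNReal.ofReal_lt_ofReal_iff_of_nonneg ht.le]
  simp only [hset] at h
  exact h.trans (liminf_le_of_frequently_le' (Frequently.of_forall fun k => hB (ns k)))

/-! ## Exact scaling of distribution functions under the blow-down -/

/-- **Scaling of superlevel sets**: if `‖g(y)‖ = R^a ‖f(Ry)‖` with `R > 0` and `a r = 3`, then
`|{t < ‖g‖}| ≤ ‖f‖^r_{r,∞} t^{-r}` — the distribution function of the rescaled field is that of
`f` at level `tR^{-a}`, times `R^{-3}` (the Lorentz-scale invariance (1.3) p.2 l.10–17, (3.20)–(3.25)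
p.10–11). [cite: Wu2026, (1.3) p.2; (3.20)–(3.25) p.10–11] -/
theorem meas_lt_norm_rescaled_le {F F' : Type*} [NormedAddCommGroup F] [NormedAddCommGroup F']
    (f : E3 → F) (g : E3 → F') {R a r : ℝ} (hR : 0 < R) (har : a * r = 3)
    (p : ℝ≥0∞) (hp : p.toReal = r)
    (hfg : ∀ y, ‖g y‖ = R ^ a * ‖f (R • y)‖) {t : ℝ} (ht : 0 < t) :
    volume {y | t < ‖g y‖} ≤ eWeakLpPow f p volume * ENNReal.ofReal (t ^ (-r)) := by
  have hRa : 0 < R ^ a := Real.rpow_pos_of_pos hR a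
  set s : ℝ := t / R ^ a with hs_def
  have hs : 0 < s := div_pos ht hRa
  have hset : {y : E3 | t < ‖g y‖} = (fun y : E3 => R • y) ⁻¹' {x | s < ‖f x‖} := by
    ext y
    simp only [mem_setOf_eq, mem_preimage, hfg y, hs_def]
    rw [div_lt_iff₀ hRa, mul_comm]
  rw [hset, Measure.addHaar_preimage_smul volume hR.ne', finrank_euclideanSpace, Fintype.card_fin]
  have hW := meas_lt_norm_le_eWeakLpPow_mul_ofReal_rpow_neg f p volume hs
  rw [hp] at hW
  calc ENNReal.ofReal (|(R ^ 3)⁻¹|) * volume {x | s < ‖f x‖}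
      ≤ ENNReal.ofReal (|(R ^ 3)⁻¹|) * (eWeakLpPow f p volume * ENNReal.ofReal (s ^ (-r))) := by
        gcongr
    _ = eWeakLpPow f p volume * (ENNReal.ofReal (|(R ^ 3)⁻¹|) * ENNReal.ofReal (s ^ (-r))) := by
        ring
    _ = eWeakLpPow f p volume * ENNReal.ofReal (t ^ (-r)) := by
        congr 1
        have h3 : R ^ (3 : ℝ) = R ^ (3 : ℕ) := by exact_mod_cast Real.rpow_natCast R 3
        have hRar : (R ^ a) ^ (-r) = (R ^ (3 : ℕ))⁻¹ := by
          rw [← Real.rpow_mul hR.le, mul_neg, har, Real.rpow_neg hR.le, h3]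
        have hreal : (R ^ (3 : ℕ))⁻¹ * s ^ (-r) = t ^ (-r) := by
          rw [hs_def, Real.div_rpow ht.le hRa.le, hRar]
          have hR3 : (R ^ (3 : ℕ))⁻¹ ≠ 0 := inv_ne_zero (pow_ne_zero 3 hR.ne')
          field_simp
        rw [← ENNReal.ofReal_mul (abs_nonneg _), abs_of_pos (inv_pos.2 (pow_pos hR 3)), hreal]

/-- `((9 : ℝ≥0∞) / 2).toReal = 9/2`. [folklore] -/
theorem toReal_nine_halves : ((9 : ℝ≥0∞) / 2).toReal = (9 : ℝ) / 2 := by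
  rw [ENNReal.toReal_div]; norm_num

/-- `((9 : ℝ≥0∞) / 4).toReal = 9/4`. [folklore] -/
theorem toReal_nine_quarters : ((9 : ℝ≥0∞) / 4).toReal = (9 : ℝ) / 4 := by
  rw [ENNReal.toReal_div]; norm_num

/-- **(3.20), uniform in the scale**: `|{t < |V_R|}| ≤ ‖v‖^{9/2}_{9/2,∞} t^{-9/2}` for the blow-down
`V_R = R^{2/3}v(R·)`, every `R > 0`. [cite: Wu2026, (3.20) p.10 l.55 – p.11 l.3] -/
theorem meas_lt_norm_blowDown_le (v : E3 → E3) {R : ℝ} (hR : 0 < R) {t : ℝ} (ht : 0 < t) :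
    volume {y | t < ‖blowDown R v y‖} ≤
      eWeakLpPow v ((9 : ℝ≥0∞) / 2) volume * ENNReal.ofReal (t ^ (-((9 : ℝ) / 2))) := by
  refine meas_lt_norm_rescaled_le v (blowDown R v) hR (a := (2 : ℝ) / 3) (r := (9 : ℝ) / 2)
    (by norm_num) _ toReal_nine_halves (fun y => ?_) ht
  unfold blowDown
  rw [norm_smul, Real.norm_of_nonneg (Real.rpow_nonneg hR.le _)]

/-- **(3.42)/(3.61), uniform in the scale**: `|{t < |Q_R|}| ≤ ‖𝒬‖^{9/4}_{9/4,∞} t^{-9/4}` for the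
rescaled Bernoulli function `Q_R = R^{4/3}𝒬(R·)` (p.15 l.8–16 «The scaling (3.38) gives
‖Q_j‖_{L^{9/4,∞}} = ‖𝒬‖_{L^{9/4,∞}}»). [cite: Wu2026, (3.42) p.15 l.8–16] -/
theorem meas_lt_abs_bern_blowDown_le (v : E3 → E3) (q : E3 → ℝ) {R : ℝ} (hR : 0 < R) {t : ℝ}
    (ht : 0 < t) :
    volume {y | t < |bern (blowDown R v) (blowDownP R q) y|} ≤
      eWeakLpPow (bern v q) ((9 : ℝ≥0∞) / 4) volume * ENNReal.ofReal (t ^ (-((9 : ℝ) / 4))) := by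
  have h := meas_lt_norm_rescaled_le (bern v q) (bern (blowDown R v) (blowDownP R q)) hR
    (a := (4 : ℝ) / 3) (r := (9 : ℝ) / 4) (by norm_num) _ toReal_nine_quarters (fun y => ?_) ht
  · simpa only [Real.norm_eq_abs] using h
  · rw [bern_blowDown hR, Real.norm_eq_abs, Real.norm_eq_abs, abs_mul,
      abs_of_pos (Real.rpow_pos_of_pos hR _)]

/-- **The product level sets**: `{t < |Q||V|} ⊆ {t^{2/3} < |Q|} ∪ {t^{1/3} < |V|}` (`t > 0`), the
splitting behind `‖QV‖_{L^{3/2,∞}(A_R)} ≤ C` in (3.61). [cite: Wu2026, (3.61) p.21 l.5–24] -/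
theorem setOf_lt_abs_mul_norm_subset (Q : E3 → ℝ) (V : E3 → E3) {t : ℝ} (ht : 0 < t) :
    {y | t < |Q y| * ‖V y‖} ⊆
      {y | t ^ ((2 : ℝ) / 3) < |Q y|} ∪ {y | t ^ ((1 : ℝ) / 3) < ‖V y‖} := by
  intro y hy
  by_contra h
  simp only [mem_union, mem_setOf_eq, not_or, not_lt] at h
  have hle : |Q y| * ‖V y‖ ≤ t ^ ((2 : ℝ) / 3) * t ^ ((1 : ℝ) / 3) :=
    mul_le_mul h.1 h.2 (norm_nonneg _) (Real.rpow_nonneg ht.le _)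
  rw [← Real.rpow_add ht] at hle
  norm_num at hle
  exact absurd (lt_of_lt_of_le hy hle) (lt_irrefl _)

/-- **(3.24)/(3.61) for the current, uniform in the scale**: `|{t < |Q_R||V_R|}| ≤
(‖v‖^{9/2}_{9/2,∞} + ‖𝒬‖^{9/4}_{9/4,∞}) t^{-3/2}`. [cite: Wu2026, (3.24) p.11, (3.61) p.21] -/
theorem meas_lt_abs_bern_mul_norm_blowDown_le (v : E3 → E3) (q : E3 → ℝ) {R : ℝ} (hR : 0 < R)
    {t : ℝ} (ht : 0 < t) :
    volume {y | t < |bern (blowDown R v) (blowDownP R q) y| * ‖blowDown R v y‖} ≤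
      (eWeakLpPow v ((9 : ℝ≥0∞) / 2) volume + eWeakLpPow (bern v q) ((9 : ℝ≥0∞) / 4) volume) *
        ENNReal.ofReal (t ^ (-((3 : ℝ) / 2))) := by
  have ht23 : 0 < t ^ ((2 : ℝ) / 3) := Real.rpow_pos_of_pos ht _
  have ht13 : 0 < t ^ ((1 : ℝ) / 3) := Real.rpow_pos_of_pos ht _
  have hQ := meas_lt_abs_bern_blowDown_le v q hR ht23
  have hV := meas_lt_norm_blowDown_le v hR ht13
  have e1 : (t ^ ((2 : ℝ) / 3)) ^ (-((9 : ℝ) / 4)) = t ^ (-((3 : ℝ) / 2)) := by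
    rw [← Real.rpow_mul ht.le]; norm_num
  have e2 : (t ^ ((1 : ℝ) / 3)) ^ (-((9 : ℝ) / 2)) = t ^ (-((3 : ℝ) / 2)) := by
    rw [← Real.rpow_mul ht.le]; norm_num
  rw [e1] at hQ
  rw [e2] at hV
  calc volume {y | t < |bern (blowDown R v) (blowDownP R q) y| * ‖blowDown R v y‖}
      ≤ volume ({y | t ^ ((2 : ℝ) / 3) < |bern (blowDown R v) (blowDownP R q) y|} ∪
          {y | t ^ ((1 : ℝ) / 3) < ‖blowDown R v y‖}) :=
        measure_mono (setOf_lt_abs_mul_norm_subset _ _ ht)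
    _ ≤ volume {y | t ^ ((2 : ℝ) / 3) < |bern (blowDown R v) (blowDownP R q) y|} +
          volume {y | t ^ ((1 : ℝ) / 3) < ‖blowDown R v y‖} := measure_union_le _ _
    _ ≤ eWeakLpPow (bern v q) ((9 : ℝ≥0∞) / 4) volume * ENNReal.ofReal (t ^ (-((3 : ℝ) / 2))) +
          eWeakLpPow v ((9 : ℝ≥0∞) / 2) volume * ENNReal.ofReal (t ^ (-((3 : ℝ) / 2))) :=
        add_le_add hQ hV
    _ = (eWeakLpPow v ((9 : ℝ≥0∞) / 2) volume + eWeakLpPow (bern v q) ((9 : ℝ≥0∞) / 4) volume) *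
          ENNReal.ofReal (t ^ (-((3 : ℝ) / 2))) := by ring

/-! ## The closed dyadic shell -/

/-- The closed shell `{R ≤ |y| ≤ 2R}` is compact. [folklore] -/
theorem isCompact_closedShell (R : ℝ) : IsCompact {y : E3 | R ≤ ‖y‖ ∧ ‖y‖ ≤ 2 * R} := by
  have hsub : {y : E3 | R ≤ ‖y‖ ∧ ‖y‖ ≤ 2 * R} ⊆ closedBall (0 : E3) (2 * R) := fun y hy => by
    rw [mem_closedBall, dist_zero_right]; exact hy.2
  refine (isCompact_closedBall (0 : E3) (2 * R)).of_isClosed_subset ?_ hsub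
  exact (isClosed_le continuous_const continuous_norm).inter
    (isClosed_le continuous_norm continuous_const)

/-- For `R > 0` the closed shell `{R ≤ |y| ≤ 2R}` lies in `ℝ³ ∖ {0}`. [folklore] -/
theorem closedShell_subset_punctured {R : ℝ} (hR : 0 < R) :
    {y : E3 | R ≤ ‖y‖ ∧ ‖y‖ ≤ 2 * R} ⊆ punctured := fun y hy => by
  show y ≠ 0
  intro h0
  have h1 : R ≤ ‖y‖ := hy.1
  rw [h0, norm_zero] at h1
  linarith

/-- The open annulus `A_R` lies in the closed shell. [folklore] -/
theorem annulus_subset_closedShell (R : ℝ) :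
    annulus R ⊆ {y : E3 | R ≤ ‖y‖ ∧ ‖y‖ ≤ 2 * R} := fun _ hy => ⟨hy.1.le, hy.2.le⟩

/-! ## `L^q(K)` convergences of the blow-down sequence, in `ℝ≥0∞` / `eLpNorm` form -/

section Conv

variable {v : E3 → E3} {q : E3 → ℝ} {V : E3 → E3} {P : E3 → ℝ} {Rj : ℕ → ℝ} {K : Set E3}

/-- (3.28) in `ℝ≥0∞` form on a set `K`: `∫⁻_K ‖V_j − V‖ₑ⁴ → 0` from the real-integral form, for
continuous `v`, compact `K`, `|V|⁴ ∈ L¹(K)`. [cite: Wu2026, (3.28) p.11 l.44–50] -/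
theorem tendsto_lintegral_V_sub_of_integral (hv : Continuous v) (hK : IsCompact K)
    (hVm : AEStronglyMeasurable V volume) (hVK : IntegrableOn (fun y => ‖V y‖ ^ (4 : ℝ)) K volume)
    (hconv : Tendsto (fun j => ∫ y in K, ‖blowDown (Rj j) v y - V y‖ ^ (4 : ℝ)) atTop (𝓝 0)) :
    Tendsto (fun j => ∫⁻ y in K, ‖blowDown (Rj j) v y - V y‖ₑ ^ (4 : ℝ)) atTop (𝓝 0) := by
  have hVj : ∀ j, Continuous (blowDown (Rj j) v) := fun j => continuous_blowDown hv _
  have heq : ∀ j, ∫⁻ y in K, ‖blowDown (Rj j) v y - V y‖ₑ ^ (4 : ℝ) =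
      ∫⁻ y in K, ENNReal.ofReal (‖blowDown (Rj j) v y - V y‖ ^ (4 : ℝ)) := fun j =>
    lintegral_congr fun y => (ofReal_norm_rpow _ (by norm_num)).symm
  simp_rw [heq]
  refine tendsto_lintegral_of_tendsto_integral (fun j y => by positivity) (fun j => ?_)
    (fun j => ?_) hconv
  · exact (((hVj j).aestronglyMeasurable.sub hVm).norm.aemeasurable.pow_const _).aestronglyMeasurable.restrict
  · rw [← heq j]
    exact (lintegral_enorm_sub_rpow_lt_top (hVj j) hK (by norm_num) hVK).ne

/-- (3.45) in `ℝ≥0∞` form on a set `K`: `∫⁻_K ‖P_j − P‖ₑ² → 0` from the real-integral form.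
[cite: Wu2026, (3.45) p.16 l.21–27] -/
theorem tendsto_lintegral_P_sub_of_integral (hq : Continuous q) (hK : IsCompact K)
    (hPm : AEStronglyMeasurable P volume)
    (hPK : IntegrableOn (fun y => |P y| ^ ((4 : ℝ) / 2)) K volume)
    (hconv : Tendsto (fun j => ∫ y in K, |blowDownP (Rj j) q y - P y| ^ ((4 : ℝ) / 2)) atTop
      (𝓝 0)) :
    Tendsto (fun j => ∫⁻ y in K, ‖blowDownP (Rj j) q y - P y‖ₑ ^ ((4 : ℝ) / 2)) atTop (𝓝 0) := by
  have hPj : ∀ j, Continuous (blowDownP (Rj j) q) := fun j => continuous_blowDownP hq _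
  have hPK' : IntegrableOn (fun y => ‖P y‖ ^ ((4 : ℝ) / 2)) K volume := by
    simpa only [Real.norm_eq_abs] using hPK
  have heq : ∀ j, ∫⁻ y in K, ‖blowDownP (Rj j) q y - P y‖ₑ ^ ((4 : ℝ) / 2) =
      ∫⁻ y in K, ENNReal.ofReal (|blowDownP (Rj j) q y - P y| ^ ((4 : ℝ) / 2)) := fun j =>
    lintegral_congr fun y => by
      rw [← Real.norm_eq_abs]; exact (ofReal_norm_rpow _ (by norm_num)).symm
  simp_rw [heq]
  refine tendsto_lintegral_of_tendsto_integral (fun j y => by positivity) (fun j => ?_)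
    (fun j => ?_) hconv
  · exact (((hPj j).aestronglyMeasurable.sub hPm).norm.aemeasurable.pow_const _).aestronglyMeasurable.restrict
  · rw [← heq j]
    exact (lintegral_enorm_sub_rpow_lt_top (hPj j) hK (by norm_num) hPK').ne

/-- From `∫⁻ ‖f_j − g‖ₑ^r → 0` to `eLpNorm (f_j − g) r → 0` (`0 < r < ∞`). [folklore] -/
theorem tendsto_eLpNorm_of_tendsto_lintegral_rpow {F : Type*} [NormedAddCommGroup F]
    {μ : Measure E3} {f : ℕ → E3 → F} {g : E3 → F} {r : ℝ} (hr : 0 < r)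
    (h : Tendsto (fun j => ∫⁻ y, ‖f j y - g y‖ₑ ^ r ∂μ) atTop (𝓝 0)) :
    Tendsto (fun j => eLpNorm (f j - g) (ENNReal.ofReal r) μ) atTop (𝓝 0) := by
  have hr0 : ENNReal.ofReal r ≠ 0 := (ENNReal.ofReal_pos.2 hr).ne'
  have hrr : (ENNReal.ofReal r).toReal = r := ENNReal.toReal_ofReal hr.le
  have heq : ∀ j, eLpNorm (f j - g) (ENNReal.ofReal r) μ =
      (∫⁻ y, ‖f j y - g y‖ₑ ^ r ∂μ) ^ (1 / r) * 1 := fun j => by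
    rw [eLpNorm_eq_lintegral_rpow_enorm_toReal hr0 ENNReal.ofReal_ne_top, hrr, mul_one]
    rfl
  simp_rw [heq]
  exact tendsto_rpow_mul_const_zero h (by positivity) ENNReal.one_ne_top

/-- `Q_j → Q` in `L¹(K)`: `∫⁻_K ‖Q_j − Q‖ₑ → 0`, `Q_j = P_j + |V_j|²/2`, `Q = P + |V|²/2`, from (3.28)
and (3.45) on a set of finite measure (`|Q_j − Q| ≤ |P_j − P| + |V_j − V|² + |V||V_j − V|`).
[cite: Wu2026, (3.45) p.16 l.21–27 («Q_j → Q strongly in L^{q₀/2}_loc»)] -/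
theorem tendsto_lintegral_bern_sub {Vj : ℕ → E3 → E3} {Pj : ℕ → E3 → ℝ} (hKfin : volume K ≠ ∞)
    (hVjm : ∀ j, AEStronglyMeasurable (Vj j) volume) (hPjm : ∀ j, AEStronglyMeasurable (Pj j) volume)
    (hVm : AEStronglyMeasurable V volume) (hPm : AEStronglyMeasurable P volume)
    (hV4 : ∫⁻ y in K, ‖V y‖ₑ ^ (4 : ℝ) ≠ ∞)
    (hdlim : Tendsto (fun j => ∫⁻ y in K, ‖Vj j y - V y‖ₑ ^ (4 : ℝ)) atTop (𝓝 0))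
    (helim : Tendsto (fun j => ∫⁻ y in K, ‖Pj j y - P y‖ₑ ^ ((4 : ℝ) / 2)) atTop (𝓝 0)) :
    Tendsto (fun j => ∫⁻ y in K, ‖bern (Vj j) (Pj j) y - bern V P y‖ₑ) atTop (𝓝 0) := by
  -- pointwise splitting
  have hpt : ∀ j y, ‖bern (Vj j) (Pj j) y - bern V P y‖ₑ ≤
      ‖Pj j y - P y‖ₑ + ‖Vj j y - V y‖ₑ ^ (2 : ℝ) + ‖V y‖ₑ * ‖Vj j y - V y‖ₑ := by
    intro j y
    have hreal : ‖bern (Vj j) (Pj j) y - bern V P y‖ ≤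
        ‖Pj j y - P y‖ + ‖Vj j y - V y‖ ^ 2 + ‖V y‖ * ‖Vj j y - V y‖ := by
      set a : E3 := Vj j y
      set b : E3 := V y
      have hd : ‖a‖ ≤ ‖b‖ + ‖a - b‖ := by
        calc ‖a‖ = ‖b + (a - b)‖ := by rw [add_sub_cancel]
          _ ≤ ‖b‖ + ‖a - b‖ := norm_add_le _ _
      have hsq : |‖a‖ ^ 2 - ‖b‖ ^ 2| ≤ ‖a - b‖ * (‖a‖ + ‖b‖) := by
        rw [sq_sub_sq, abs_mul, mul_comm]
        gcongr
        · exact abs_norm_sub_norm_le a b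
        · exact le_of_eq (abs_of_nonneg (by positivity))
      have e : bern (Vj j) (Pj j) y - bern V P y = (Pj j y - P y) + (‖a‖ ^ 2 - ‖b‖ ^ 2) / 2 := by
        simp only [bern]; ring
      rw [e]
      refine (norm_add_le _ _).trans ?_
      rw [add_assoc]
      gcongr
      rw [Real.norm_eq_abs, abs_div, abs_two]
      have h0 : 0 ≤ ‖a - b‖ := norm_nonneg _
      have hb0 : 0 ≤ ‖b‖ := norm_nonneg _
      nlinarith [mul_le_mul_of_nonneg_left hd h0, hsq, mul_nonneg h0 hb0, mul_nonneg h0 h0]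
    have e2 : ‖Vj j y - V y‖ ^ (2 : ℝ) = ‖Vj j y - V y‖ ^ (2 : ℕ) := by
      exact_mod_cast Real.rpow_natCast ‖Vj j y - V y‖ 2
    rw [← ofReal_norm, ← ofReal_norm (Pj j y - P y), ← ofReal_norm (Vj j y - V y),
      ← ofReal_norm (V y),
      ENNReal.ofReal_rpow_of_nonneg (norm_nonneg _) (by norm_num : (0 : ℝ) ≤ 2),
      ← ENNReal.ofReal_mul (norm_nonneg _), ← ENNReal.ofReal_add (by positivity) (by positivity),
      ← ENNReal.ofReal_add (by positivity) (by positivity)]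
    refine ENNReal.ofReal_le_ofReal ?_
    rw [e2]
    exact hreal
  -- measurability on `K`
  have hd : ∀ j, AEMeasurable (fun y => ‖Vj j y - V y‖ₑ) (volume.restrict K) :=
    fun j => ((hVjm j).sub hVm).enorm.restrict
  have he : ∀ j, AEMeasurable (fun y => ‖Pj j y - P y‖ₑ) (volume.restrict K) :=
    fun j => ((hPjm j).sub hPm).enorm.restrict
  have hVe : AEMeasurable (fun y => ‖V y‖ₑ) (volume.restrict K) := hVm.enorm.restrict
  -- the three terms
  have h1 : Tendsto (fun j => ∫⁻ y in K, ‖Pj j y - P y‖ₑ) atTop (𝓝 0) := by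
    have hb : ∀ j, ∫⁻ y in K, ‖Pj j y - P y‖ₑ ≤
        (∫⁻ y in K, ‖Pj j y - P y‖ₑ ^ ((4 : ℝ) / 2)) ^ ((1 : ℝ) / ((4 : ℝ) / 2)) *
          volume K ^ (1 - 1 / ((4 : ℝ) / 2)) := fun j => by
      have := setLIntegral_rpow_le_of_lt (he j) (s := 1) (r := (4 : ℝ) / 2) one_pos (by norm_num)
      simpa only [ENNReal.rpow_one] using this
    refine tendsto_zero_of_le ?_ hb
    exact tendsto_rpow_mul_const_zero helim (by norm_num)
      (ENNReal.rpow_ne_top_of_nonneg (by norm_num) hKfin)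
  have h2lim : Tendsto (fun j => ∫⁻ y in K, ‖Vj j y - V y‖ₑ ^ (2 : ℝ)) atTop (𝓝 0) := by
    have hb : ∀ j, ∫⁻ y in K, ‖Vj j y - V y‖ₑ ^ (2 : ℝ) ≤
        (∫⁻ y in K, ‖Vj j y - V y‖ₑ ^ (4 : ℝ)) ^ ((2 : ℝ) / 4) * volume K ^ (1 - (2 : ℝ) / 4) :=
      fun j => setLIntegral_rpow_le_of_lt (hd j) (by norm_num) (by norm_num)
    refine tendsto_zero_of_le ?_ hb
    exact tendsto_rpow_mul_const_zero hdlim (by norm_num)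
      (ENNReal.rpow_ne_top_of_nonneg (by norm_num) hKfin)
  have hV2 : ∫⁻ y in K, ‖V y‖ₑ ^ (2 : ℝ) ≠ ∞ := by
    refine ne_top_of_le_ne_top ?_ (setLIntegral_rpow_le_of_lt hVe (by norm_num : (0:ℝ) < 2)
      (by norm_num : (2 : ℝ) < 4))
    exact ENNReal.mul_ne_top (ENNReal.rpow_ne_top_of_nonneg (by norm_num) hV4)
      (ENNReal.rpow_ne_top_of_nonneg (by norm_num) hKfin)
  have h3 : Tendsto (fun j => ∫⁻ y in K, ‖V y‖ₑ * ‖Vj j y - V y‖ₑ) atTop (𝓝 0) := by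
    have hb : ∀ j, ∫⁻ y in K, ‖V y‖ₑ * ‖Vj j y - V y‖ₑ ≤
        (∫⁻ y in K, ‖V y‖ₑ ^ ((1 : ℝ) / 2)⁻¹) ^ ((1 : ℝ) / 2) *
          (∫⁻ y in K, ‖Vj j y - V y‖ₑ ^ ((1 : ℝ) / 2)⁻¹) ^ ((1 : ℝ) / 2) := fun j =>
      setLIntegral_mul_le_holder hVe (hd j) (by norm_num) (by norm_num) (by norm_num)
    have einv : ((1 : ℝ) / 2)⁻¹ = 2 := by norm_num
    simp only [einv] at hb
    refine tendsto_zero_of_le ?_ hb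
    have := tendsto_rpow_mul_const_zero h2lim (by norm_num : (0 : ℝ) < 1 / 2)
      (ENNReal.rpow_ne_top_of_nonneg (by norm_num : (0 : ℝ) ≤ 1 / 2) hV2)
    simpa only [mul_comm] using this
  have hsum := (h1.add h2lim).add h3
  simp only [add_zero] at hsum
  refine tendsto_zero_of_le hsum fun j => ?_
  calc ∫⁻ y in K, ‖bern (Vj j) (Pj j) y - bern V P y‖ₑ
      ≤ ∫⁻ y in K, (‖Pj j y - P y‖ₑ + ‖Vj j y - V y‖ₑ ^ (2 : ℝ) + ‖V y‖ₑ * ‖Vj j y - V y‖ₑ) :=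
        lintegral_mono fun y => hpt j y
    _ = (∫⁻ y in K, ‖Pj j y - P y‖ₑ) + (∫⁻ y in K, ‖Vj j y - V y‖ₑ ^ (2 : ℝ)) +
          ∫⁻ y in K, ‖V y‖ₑ * ‖Vj j y - V y‖ₑ := by
        have hm12 : AEMeasurable (fun y => ‖Pj j y - P y‖ₑ + ‖Vj j y - V y‖ₑ ^ (2 : ℝ))
            (volume.restrict K) := (he j).add ((hd j).pow_const _)
        rw [lintegral_add_left' hm12, lintegral_add_left' (he j)]

/-- `Q_jV_j → QV` in `L¹(K)` from (3.28)/(3.45), `q₀ = 4 > 3` (the tree's six-term Hölder lemma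
`tendsto_lintegral_six_terms`). [cite: Wu2026, (3.85) proof p.26 l.68–76; (3.61) p.21] -/
theorem tendsto_lintegral_bernV_sub_raw {Vj : ℕ → E3 → E3} {Pj : ℕ → E3 → ℝ}
    (hKfin : volume K ≠ ∞)
    (hVjm : ∀ j, AEStronglyMeasurable (Vj j) volume) (hPjm : ∀ j, AEStronglyMeasurable (Pj j) volume)
    (hVm : AEStronglyMeasurable V volume) (hPm : AEStronglyMeasurable P volume)
    (hV4 : ∫⁻ y in K, ‖V y‖ₑ ^ (4 : ℝ) ≠ ∞) (hP2 : ∫⁻ y in K, ‖P y‖ₑ ^ ((4 : ℝ) / 2) ≠ ∞)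
    (hdlim : Tendsto (fun j => ∫⁻ y in K, ‖Vj j y - V y‖ₑ ^ (4 : ℝ)) atTop (𝓝 0))
    (helim : Tendsto (fun j => ∫⁻ y in K, ‖Pj j y - P y‖ₑ ^ ((4 : ℝ) / 2)) atTop (𝓝 0)) :
    Tendsto (fun j => ∫⁻ y in K, ‖bern (Vj j) (Pj j) y • Vj j y - bern V P y • V y‖ₑ) atTop
      (𝓝 0) := by
  have hd : ∀ j, AEMeasurable (fun y => ‖Vj j y - V y‖ₑ) (volume.restrict K) :=
    fun j => ((hVjm j).sub hVm).enorm.restrict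
  have he : ∀ j, AEMeasurable (fun y => ‖Pj j y - P y‖ₑ) (volume.restrict K) :=
    fun j => ((hPjm j).sub hPm).enorm.restrict
  have hVe : AEMeasurable (fun y => ‖V y‖ₑ) (volume.restrict K) := hVm.enorm.restrict
  have hPe : AEMeasurable (fun y => ‖P y‖ₑ) (volume.restrict K) := hPm.enorm.restrict
  have hsix := tendsto_lintegral_six_terms hKfin hd he hVe hPe (by norm_num : (3 : ℝ) < 4) hV4 hP2
    hdlim helim
  exact tendsto_zero_of_le hsix fun j => lintegral_mono fun y => enorm_bernV_sub_le _ _ _ _ y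

end Conv


end Summit.NavierStokesRegularity.NavierStokesRegularity.Theorems.Wu2026Salvage

end

-- WHAT THIS IS NOT: not a claim about NS regularity or blow-up; not a claim about any author beyond the typed locator.
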